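import Literature.Topology.FourManifolds.CyclicCoverMayerVietoris
import HarnessLib

/-!
# Cut data from a trivialised band (a bicollared two-sided hypersurface)

Topic `Literature/Topology/FourManifolds`; the topological input of the Mayer–Vietoris presentation
of `H₁` of an infinite cyclic cover (`CyclicCoverMayerVietoris.lean`, `AlexanderPresentationOfCut.lean`;
D. Rolfsen, *Knots and Links* (1976), §5.C "bicollars", §8.C). A **trivialised band** on a space `X`
is a continuous `τ : X → ℝ` together with a homeomorphism `Ψ : L × (-1, 1) ≃ₜ τ⁻¹(-1, 1)`,
`L = τ⁻¹(0)`, over `τ` (`τ (Ψ (y, t)) = t`): the model is the collar coordinate of a bicollar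
`F × (-1, 1) ↪ S³ ∖ K` of a Seifert surface, extended by `±1`. From it we build the circle-valued
map `f = exp (iπ · clamp τ)` (`clamp` the truncation to `[-1, 1]`), which is `1` exactly on `L` and
`-1` exactly off the open band, and the cut data `BandData.cutData : CutData f` with
`Y = {τ ≠ 0}`, `N = {|τ| < 1}`; its two sides are `N₊ = {0 < τ < 1}`, `N₋ = {-1 < τ < 0}`.

Besides the map, the cut data and the description of the sides, the file proves the homological
hypotheses of `CutData.exists_presentation` for this cut: `N`, `N₊`, `N₋` are homeomorphic to
`L × (-1, 1)`, `L × (0, 1)`, `L × (-1, 0)` (so path connected when `L` is), and `j₊`, `j₋` are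
bijective on homology (the inclusions of subinterval products are homotopy equivalences).
Everything is proved; no named fact is introduced.

## References

* D. Rolfsen, *Knots and Links*, Publish or Perish (1976), §5.C, §8.C. [Rolfsen1976]
-/

noncomputable section

open Set Function CategoryTheory
open scoped Real Topology
open Literature.AlgebraicTopology.SingularHomology

universe u

namespace Literature.Topology.FourManifolds

namespace CircleMaps

namespace CyclicCover

variable {X : Type u} [TopologicalSpace X]

/-- **A trivialised band**: a continuous real function `τ` with a trivialisation
`Ψ : τ⁻¹(0) × (-1, 1) ≃ₜ τ⁻¹(-1, 1)` over `τ` (Rolfsen 1976, §5.C: a bicollar of a two-sided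
surface, read through its collar coordinate). [cite: Rolfsen1976, §5.C] -/
structure BandData (X : Type u) [TopologicalSpace X] where
  /-- the collar coordinate, extended to all of `X` -/
  τ : C(X, ℝ)
  /-- the trivialisation of the open band over the collar coordinate -/
  Ψ : ↥(τ ⁻¹' {0}) × Ioo (-1 : ℝ) 1 ≃ₜ ↥(τ ⁻¹' Ioo (-1 : ℝ) 1)
  /-- the trivialisation is over `τ` -/
  τ_Ψ : ∀ (y : ↥(τ ⁻¹' {0})) (t : Ioo (-1 : ℝ) 1), τ (Ψ (y, t) : X) = t

namespace BandData

variable (B : BandData X)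

/-- The collar coordinate truncated to `[-1, 1]`. [folklore] -/
def clamp (x : X) : ℝ := max (-1) (min 1 (B.τ x))

/-- The truncation is continuous. [folklore] -/
@[fun_prop]
theorem continuous_clamp : Continuous B.clamp :=
  continuous_const.max (continuous_const.min B.τ.continuous)

/-- `clamp x ∈ [-1, 1]`. [folklore] -/
theorem clamp_mem (x : X) : B.clamp x ∈ Icc (-1 : ℝ) 1 :=
  ⟨le_max_left _ _, max_le (by norm_num) (min_le_left _ _)⟩

/-- On the band the truncation is `τ`. [folklore] -/
theorem clamp_eq_of_mem {x : X} (hx : B.τ x ∈ Icc (-1 : ℝ) 1) : B.clamp x = B.τ x := by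
  rw [clamp, min_eq_right hx.2, max_eq_right hx.1]

/-- `clamp x = 0 ↔ τ x = 0`. [folklore] -/
theorem clamp_eq_zero_iff {x : X} : B.clamp x = 0 ↔ B.τ x = 0 := by
  constructor
  · intro h
    rw [clamp] at h
    rcases le_total 1 (B.τ x) with h1 | h1
    · rw [min_eq_left h1] at h
      have : max (-1 : ℝ) 1 = 1 := by norm_num
      rw [this] at h
      exact absurd h one_ne_zero
    · rw [min_eq_right h1] at h
      rcases le_total (-1) (B.τ x) with h2 | h2
      · rwa [max_eq_right h2] at h
      · rw [max_eq_left h2] at h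
        norm_num at h
  · intro h
    rw [clamp, h]
    norm_num

/-- `|clamp x| = 1 ↔ 1 ≤ |τ x|`. [folklore] -/
theorem abs_clamp_eq_one_iff {x : X} : |B.clamp x| = 1 ↔ 1 ≤ |B.τ x| := by
  rw [clamp]
  rcases le_total 1 (B.τ x) with h1 | h1
  · rw [min_eq_left h1, show max (-1 : ℝ) 1 = 1 by norm_num, abs_one]
    exact ⟨fun _ => h1.trans (le_abs_self _), fun _ => rfl⟩
  · rw [min_eq_right h1]
    rcases le_total (-1) (B.τ x) with h2 | h2
    · rw [max_eq_right h2, abs_eq (zero_le_one' ℝ), le_abs]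
      constructor
      · rintro (h | h)
        · exact Or.inl h.ge
        · exact Or.inr (by linarith)
      · rintro (h | h)
        · exact Or.inl (le_antisymm h1 h)
        · exact Or.inr (by linarith)
    · rw [max_eq_left h2, abs_neg, abs_one]
      exact ⟨fun _ => le_abs.2 (Or.inr (by linarith)), fun _ => rfl⟩

/-- **The circle-valued map of the band**: `exp (iπ · clamp τ)`. [cite: Rolfsen1976, §5.C] -/
def circleMap : C(X, Circle) :=
  ⟨fun x => Circle.exp (π * B.clamp x), by fun_prop⟩

/-- `circleMap x = exp (π · clamp x)`. [folklore] -/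
theorem circleMap_apply (x : X) : B.circleMap x = Circle.exp (π * B.clamp x) := rfl

/-- **`circleMap x = 1` exactly on the cut `τ = 0`.** [folklore] -/
theorem circleMap_eq_one_iff {x : X} : B.circleMap x = Circle.exp 0 ↔ B.τ x = 0 := by
  rw [circleMap_apply, ← B.clamp_eq_zero_iff]
  constructor
  · intro h
    obtain ⟨m, hm⟩ := Circle.exp_eq_exp.1 h
    have hc := B.clamp_mem x
    have h1 : (2 * (m : ℝ) - 0) * π = π * B.clamp x - 0 := by rw [hm]; ring
    have habs : |2 * (m : ℝ)| ≤ 1 := by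
      have : 2 * (m : ℝ) = B.clamp x := by
        have := h1; field_simp at this ⊢; nlinarith [Real.pi_pos]
      rw [this, abs_le]; exact ⟨by linarith [hc.1], hc.2⟩
    have hm0 : m = 0 := by
      have : |(m : ℝ)| < 1 := by
        rw [abs_mul, abs_two] at habs; linarith [abs_nonneg (m : ℝ)]
      exact Int.abs_lt_one_iff.1 (by exact_mod_cast this)
    have : 2 * (m : ℝ) = B.clamp x := by
      have := h1; field_simp at this ⊢; nlinarith [Real.pi_pos]
    rw [hm0] at this
    simpa using this.symm
  · intro h
    rw [h, mul_zero]

/-- `π c = -π + 2πm` forces `c = 2m - 1`. [folklore] -/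
theorem eq_two_mul_sub_one_of_pi_mul_eq {c : ℝ} {m : ℤ} (h : π * c = -π + m * (2 * π)) : c = 2 * m - 1 := by
  have hπ : π ≠ 0 := Real.pi_pos.ne'
  have : π * c = π * (2 * m - 1) := by rw [h]; ring
  exact mul_left_cancel₀ hπ this

/-- **`circleMap x = -1` exactly off the open band `|τ| < 1`.** [folklore] -/
theorem circleMap_eq_exp_neg_pi_iff {x : X} : B.circleMap x = Circle.exp (-π) ↔ 1 ≤ |B.τ x| := by
  rw [circleMap_apply, ← B.abs_clamp_eq_one_iff]
  constructor
  · intro h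
    obtain ⟨m, hm⟩ := Circle.exp_eq_exp.1 h
    have hc := eq_two_mul_sub_one_of_pi_mul_eq hm
    have hmem := B.clamp_mem x
    rw [hc] at hmem ⊢
    have h0 : (0 : ℝ) ≤ m := by linarith [hmem.1]
    have h1 : (m : ℝ) ≤ 1 := by linarith [hmem.2]
    have : m = 0 ∨ m = 1 := by
      have h0' : (0 : ℤ) ≤ m := by exact_mod_cast h0
      have h1' : m ≤ 1 := by exact_mod_cast h1
      omega
    rcases this with rfl | rfl <;> norm_num
  · intro h
    rcases (abs_eq (zero_le_one' ℝ)).1 h with h1 | h1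
    · rw [h1, mul_one, CutData.exp_neg_pi]
    · rw [h1, mul_neg, mul_one]

/-- On the open band, `|τ| < 1`. [folklore] -/
theorem abs_lt_one_iff {x : X} : |B.τ x| < 1 ↔ B.circleMap x ≠ Circle.exp (-π) := by
  rw [Ne, circleMap_eq_exp_neg_pi_iff, not_le]

/-- **The cut data of a trivialised band**: `Y = {τ ≠ 0}`, `N = {|τ| < 1}` (Rolfsen 1976, §8.C:
`Y = S³ ∖ F`, `N` a bicollar of the Seifert surface). [cite: Rolfsen1976, §8.C] -/
def cutData : CutData B.circleMap where
  Y := {x | B.τ x ≠ 0}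
  N := {x | |B.τ x| < 1}
  isOpen_Y := isOpen_ne_fun B.τ.continuous continuous_const
  isOpen_N := isOpen_lt (continuous_abs.comp B.τ.continuous) continuous_const
  union_eq := by
    ext x
    simp only [mem_union, mem_setOf_eq, mem_univ, iff_true]
    by_cases h : B.τ x = 0
    · right; rw [h, abs_zero]; exact one_pos
    · left; exact h
  ne_one x hx := fun h => hx (B.circleMap_eq_one_iff.1 h)
  ne_neg_one x hx := B.abs_lt_one_iff.1 hx

/-- Membership in `Y`. [folklore] -/
@[simp] theorem mem_cutData_Y {x : X} : x ∈ B.cutData.Y ↔ B.τ x ≠ 0 := Iff.rfl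

/-- Membership in `N`. [folklore] -/
@[simp] theorem mem_cutData_N {x : X} : x ∈ B.cutData.N ↔ |B.τ x| < 1 := Iff.rfl

/-! ### The two sides of the cut -/

/-- On the open band the branch of the level is `π τ` on the plus side. [folklore] -/
theorem sheetLevel_eq_of_pos {x : X} (hx : |B.τ x| < 1) (hpos : 0 < B.τ x) :
    sheetLevel B.circleMap 0 x = π * B.τ x := by
  have hmem : B.τ x ∈ Icc (-1 : ℝ) 1 := ⟨by linarith [(abs_lt.1 hx).1], (abs_lt.1 hx).2.le⟩
  have hs := sheetLevel_mem_Ioo B.circleMap 0 (x := x) (by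
    rw [Ne, circleMap_eq_one_iff]; exact hpos.ne')
  refine eq_of_exp_eq_of_mem_Ioo (b := 0) ?_ ⟨hs.1, by linarith [hs.2]⟩ ⟨by positivity, ?_⟩
  · rw [exp_sheetLevel, circleMap_apply, B.clamp_eq_of_mem hmem]
  · have := (abs_lt.1 hx).2
    nlinarith [Real.pi_pos]

/-- On the minus side the branch of the level is `π τ + 2π`. [folklore] -/
theorem sheetLevel_eq_of_neg {x : X} (hx : |B.τ x| < 1) (hneg : B.τ x < 0) :
    sheetLevel B.circleMap 0 x = π * B.τ x + 2 * π := by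
  have hmem : B.τ x ∈ Icc (-1 : ℝ) 1 := ⟨(abs_lt.1 hx).1.le, by linarith [(abs_lt.1 hx).2]⟩
  have hs := sheetLevel_mem_Ioo B.circleMap 0 (x := x) (by
    rw [Ne, circleMap_eq_one_iff]; exact hneg.ne)
  refine eq_of_exp_eq_of_mem_Ioo (b := 0) ?_ ⟨hs.1, by linarith [hs.2]⟩ ⟨?_, by nlinarith [Real.pi_pos]⟩
  · rw [exp_sheetLevel, Circle.exp_add, Circle.exp_two_pi, mul_one, circleMap_apply, B.clamp_eq_of_mem hmem]
  · have := (abs_lt.1 hx).1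
    nlinarith [Real.pi_pos]

/-- **The plus side is `{0 < τ < 1}`.** [folklore] -/
theorem mem_plus_iff' {x : X} : x ∈ B.cutData.plus ↔ 0 < B.τ x ∧ B.τ x < 1 := by
  rw [CutData.mem_plus_iff, mem_cutData_Y, mem_cutData_N]
  constructor
  · rintro ⟨⟨h0, h1⟩, hl⟩
    refine ⟨?_, (abs_lt.1 h1).2⟩
    rcases lt_or_gt_of_ne h0 with hneg | hpos
    · rw [B.sheetLevel_eq_of_neg h1 hneg] at hl
      have := (abs_lt.1 h1).1
      nlinarith [Real.pi_pos]
    · exact hpos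
  · rintro ⟨h0, h1⟩
    have habs : |B.τ x| < 1 := abs_lt.2 ⟨by linarith, h1⟩
    refine ⟨⟨h0.ne', habs⟩, ?_⟩
    show sheetLevel B.circleMap 0 x < π
    rw [B.sheetLevel_eq_of_pos habs h0]
    nlinarith [Real.pi_pos]

/-- **The minus side is `{-1 < τ < 0}`.** [folklore] -/
theorem mem_minus_iff' {x : X} : x ∈ B.cutData.minus ↔ -1 < B.τ x ∧ B.τ x < 0 := by
  rw [CutData.mem_minus_iff, mem_cutData_Y, mem_cutData_N]
  constructor
  · rintro ⟨⟨h0, h1⟩, hl⟩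
    refine ⟨(abs_lt.1 h1).1, ?_⟩
    rcases lt_or_gt_of_ne h0 with hneg | hpos
    · exact hneg
    · have hl' : π < sheetLevel B.circleMap 0 x := hl
      rw [B.sheetLevel_eq_of_pos h1 hpos] at hl'
      have := (abs_lt.1 h1).2
      nlinarith [Real.pi_pos]
  · rintro ⟨h0, h1⟩
    have habs : |B.τ x| < 1 := abs_lt.2 ⟨h0, by linarith⟩
    refine ⟨⟨h1.ne, habs⟩, ?_⟩
    show π < sheetLevel B.circleMap 0 x
    rw [B.sheetLevel_eq_of_neg habs h1]
    nlinarith [Real.pi_pos]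

/-! ### Products with subintervals: the inclusion is a homotopy equivalence -/

section Intervals

variable (L : Type u) [TopologicalSpace L] {a b c d : ℝ}

/-- The inclusion `L × (c, d) ↪ L × (a, b)` for `a ≤ c`, `d ≤ b`. [folklore] -/
def inclIoo (hac : a ≤ c) (hdb : d ≤ b) : C(L × Ioo c d, L × Ioo a b) :=
  ⟨fun p => (p.1, ⟨p.2.1, lt_of_le_of_lt hac p.2.2.1, lt_of_lt_of_le p.2.2.2 hdb⟩), by fun_prop⟩

/-- The retraction `L × (a, b) → L × (c, d)` onto the slice `t = m`. [folklore] -/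
def retrIoo {m : ℝ} (hm : m ∈ Ioo c d) : C(L × Ioo a b, L × Ioo c d) :=
  ⟨fun p => (p.1, ⟨m, hm⟩), by fun_prop⟩

/-- A convex combination of two points of an open interval lies in it. [folklore] -/
theorem convexComb_mem_Ioo {u v : ℝ} (hu : u ∈ Ioo a b) (hv : v ∈ Ioo a b) (s : unitInterval) :
    (1 - (s : ℝ)) * u + (s : ℝ) * v ∈ Ioo a b := by
  have hs0 : 0 ≤ (s : ℝ) := s.2.1
  have hs1 : (s : ℝ) ≤ 1 := s.2.2
  obtain ⟨hua, hub⟩ := hu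
  obtain ⟨hva, hvb⟩ := hv
  rcases eq_or_lt_of_le hs1 with hs | hs
  · rw [hs]; constructor <;> linarith
  · constructor
    · nlinarith [mul_pos (sub_pos.2 hs) (sub_pos.2 hua), mul_nonneg hs0 (sub_pos.2 hva).le]
    · nlinarith [mul_pos (sub_pos.2 hs) (sub_pos.2 hub), mul_nonneg hs0 (sub_pos.2 hvb).le]

/-- `incl ∘ retr ≃ id` on `L × (a, b)` (straight-line homotopy in the interval coordinate).
[folklore] -/
def homotopyInclRetr (hac : a ≤ c) (hdb : d ≤ b) {m : ℝ} (hm : m ∈ Ioo c d) :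
    ContinuousMap.Homotopy (ContinuousMap.id (L × Ioo a b)) ((inclIoo L hac hdb).comp (retrIoo L hm)) where
  toFun q := (q.2.1, ⟨(1 - (q.1 : ℝ)) * q.2.2.1 + (q.1 : ℝ) * m,
    convexComb_mem_Ioo q.2.2.2 ⟨lt_of_le_of_lt hac hm.1, lt_of_lt_of_le hm.2 hdb⟩ q.1⟩)
  continuous_toFun := by fun_prop
  map_zero_left p := by ext <;> simp
  map_one_left p := by ext <;> simp [inclIoo, retrIoo]

/-- `retr ∘ incl ≃ id` on `L × (c, d)`. [folklore] -/
def homotopyRetrIncl (hac : a ≤ c) (hdb : d ≤ b) {m : ℝ} (hm : m ∈ Ioo c d) :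
    ContinuousMap.Homotopy (ContinuousMap.id (L × Ioo c d)) ((retrIoo L hm).comp (inclIoo L hac hdb)) where
  toFun q := (q.2.1, ⟨(1 - (q.1 : ℝ)) * q.2.2.1 + (q.1 : ℝ) * m, convexComb_mem_Ioo q.2.2.2 hm q.1⟩)
  continuous_toFun := by fun_prop
  map_zero_left p := by ext <;> simp
  map_one_left p := by ext <;> simp [inclIoo, retrIoo]

variable (R : Type) [CommRing R] (M : Type) [AddCommGroup M] [Module R M]

/-- **The inclusion `L × (c, d) ↪ L × (a, b)` induces bijections on singular homology** (it is a
homotopy equivalence; Hatcher Cor. 2.11). [cite: HatcherAT2002, Cor. 2.11] -/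
theorem bijective_map_inclIoo (hac : a ≤ c) (hdb : d ≤ b) (hcd : c < d) (n : ℕ) :
    Bijective (singularHomology.map R M (inclIoo L hac hdb) n) := by
  obtain ⟨m, hm⟩ : (Ioo c d).Nonempty := nonempty_Ioo.2 hcd
  have h1 : singularHomology.map R M (retrIoo L (a := a) (b := b) hm) n ≫
      singularHomology.map R M (inclIoo L hac hdb) n = 𝟙 _ := by
    rw [← singularHomology.map_comp, ← singularHomology.map_eq_of_homotopic R M ⟨homotopyInclRetr L hac hdb hm⟩,
      singularHomology.map_id]
  have h2 : singularHomology.map R M (inclIoo L hac hdb) n ≫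
      singularHomology.map R M (retrIoo L (a := a) (b := b) hm) n = 𝟙 _ := by
    rw [← singularHomology.map_comp, ← singularHomology.map_eq_of_homotopic R M ⟨homotopyRetrIncl L hac hdb hm⟩,
      singularHomology.map_id]
  constructor
  · intro x y hxy
    have := congrArg (singularHomology.map R M (retrIoo L (a := a) (b := b) hm) n) hxy
    rwa [← ModuleCat.comp_apply, ← ModuleCat.comp_apply, h2, ModuleCat.id_apply, ModuleCat.id_apply] at this
  · intro z
    refine ⟨singularHomology.map R M (retrIoo L (a := a) (b := b) hm) n z, ?_⟩
    rw [← ModuleCat.comp_apply, h1, ModuleCat.id_apply]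

end Intervals

/-! ### Coordinates on the band and its sides -/

/-- The band coordinates of a point of the open band. [folklore] -/
def coordOf (x : X) (hx : B.τ x ∈ Ioo (-1 : ℝ) 1) : ↥(B.τ ⁻¹' {0}) × Ioo (-1 : ℝ) 1 := B.Ψ.symm ⟨x, hx⟩

/-- The interval coordinate is `τ`. [folklore] -/
theorem coe_snd_coordOf (x : X) (hx : B.τ x ∈ Ioo (-1 : ℝ) 1) : ((B.coordOf x hx).2 : ℝ) = B.τ x := by
  have h := B.τ_Ψ (B.coordOf x hx).1 (B.coordOf x hx).2
  rw [Prod.mk.eta, coordOf, Homeomorph.apply_symm_apply] at h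
  exact h.symm

/-- `Ψ` of the coordinates is the point. [folklore] -/
theorem Ψ_coordOf (x : X) (hx : B.τ x ∈ Ioo (-1 : ℝ) 1) : (B.Ψ (B.coordOf x hx) : X) = x := by
  rw [coordOf, Homeomorph.apply_symm_apply]

/-- The coordinates of `Ψ p` are `p`. [folklore] -/
theorem coordOf_Ψ (p : ↥(B.τ ⁻¹' {0}) × Ioo (-1 : ℝ) 1) (h : B.τ (B.Ψ p : X) ∈ Ioo (-1 : ℝ) 1) :
    B.coordOf (B.Ψ p) h = p := by
  rw [coordOf]
  exact (congrArg B.Ψ.symm (Subtype.ext rfl)).trans (B.Ψ.symm_apply_apply p)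

/-- Points of `N` have `τ ∈ (-1, 1)`. [folklore] -/
theorem τ_mem_Ioo_of_mem_N {x : X} (hx : x ∈ B.cutData.N) : B.τ x ∈ Ioo (-1 : ℝ) 1 := abs_lt.1 hx

/-- `Ψ q` lies in `N`. [folklore] -/
theorem Ψ_mem_N (q : ↥(B.τ ⁻¹' {0}) × Ioo (-1 : ℝ) 1) : (B.Ψ q : X) ∈ B.cutData.N := by
  show |B.τ (B.Ψ q)| < 1
  have h := B.τ_Ψ q.1 q.2
  rw [Prod.mk.eta] at h
  rw [h]
  exact abs_lt.2 q.2.2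

/-- **`N ≃ₜ L × (-1, 1)`** (the trivialisation). [folklore] -/
def homeoN : ↥B.cutData.N ≃ₜ ↥(B.τ ⁻¹' {0}) × Ioo (-1 : ℝ) 1 where
  toFun x := B.coordOf x (B.τ_mem_Ioo_of_mem_N x.2)
  invFun q := ⟨B.Ψ q, B.Ψ_mem_N q⟩
  left_inv x := Subtype.ext (B.Ψ_coordOf x _)
  right_inv q := B.coordOf_Ψ q _
  continuous_toFun := B.Ψ.symm.continuous.comp (continuous_subtype_val.subtype_mk _)
  continuous_invFun := (continuous_subtype_val.comp B.Ψ.continuous).subtype_mk _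

/-- Points of `N₊` have `τ ∈ (-1, 1)`. [folklore] -/
theorem τ_mem_Ioo_of_mem_plus {x : X} (hx : x ∈ B.cutData.plus) : B.τ x ∈ Ioo (-1 : ℝ) 1 :=
  B.τ_mem_Ioo_of_mem_N (B.cutData.plus_subset_N hx)

/-- Points of `N₋` have `τ ∈ (-1, 1)`. [folklore] -/
theorem τ_mem_Ioo_of_mem_minus {x : X} (hx : x ∈ B.cutData.minus) : B.τ x ∈ Ioo (-1 : ℝ) 1 :=
  B.τ_mem_Ioo_of_mem_N (B.cutData.minus_subset_N hx)

/-- The coordinates of a point of `N₊`, with interval coordinate in `(0, 1)`. [folklore] -/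
def plusCoord (x : ↥B.cutData.plus) : ↥(B.τ ⁻¹' {0}) × Ioo (0 : ℝ) 1 :=
  ((B.coordOf x (B.τ_mem_Ioo_of_mem_plus x.2)).1,
    ⟨(B.coordOf x (B.τ_mem_Ioo_of_mem_plus x.2)).2, by
      rw [B.coe_snd_coordOf]; exact B.mem_plus_iff'.1 x.2⟩)

/-- The point of `N₊` with given coordinates. [folklore] -/
def plusPoint (q : ↥(B.τ ⁻¹' {0}) × Ioo (0 : ℝ) 1) : ↥B.cutData.plus :=
  ⟨B.Ψ (q.1, ⟨q.2.1, by linarith [q.2.2.1], q.2.2.2⟩), by rw [mem_plus_iff', B.τ_Ψ]; exact q.2.2⟩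

/-- **`N₊ ≃ₜ L × (0, 1)`.** [folklore] -/
def homeoPlus : ↥B.cutData.plus ≃ₜ ↥(B.τ ⁻¹' {0}) × Ioo (0 : ℝ) 1 where
  toFun := B.plusCoord
  invFun := B.plusPoint
  left_inv x := by
    apply Subtype.ext
    change (B.Ψ (_, _) : X) = x
    rw [show ((B.plusCoord x).1, (⟨((B.plusCoord x).2 : ℝ), by linarith [(B.plusCoord x).2.2.1], (B.plusCoord x).2.2.2⟩ :
        Ioo (-1 : ℝ) 1)) = B.coordOf x (B.τ_mem_Ioo_of_mem_plus x.2) from Prod.ext rfl (Subtype.ext rfl)]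
    exact B.Ψ_coordOf x _
  right_inv q := by
    have hc : B.coordOf (B.plusPoint q : X) (B.τ_mem_Ioo_of_mem_plus (B.plusPoint q).2) =
        (q.1, ⟨q.2.1, by linarith [q.2.2.1], q.2.2.2⟩) := B.coordOf_Ψ _ _
    refine Prod.ext ?_ (Subtype.ext ?_)
    · show (B.coordOf _ _).1 = q.1
      rw [hc]
    · show ((B.coordOf _ _).2 : ℝ) = q.2
      rw [hc]
  continuous_toFun := by
    refine Continuous.prodMk ?_ ?_
    · exact continuous_fst.comp (B.Ψ.symm.continuous.comp (continuous_subtype_val.subtype_mk _))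
    · exact (continuous_subtype_val.comp (continuous_snd.comp
        (B.Ψ.symm.continuous.comp (continuous_subtype_val.subtype_mk _)))).subtype_mk _
  continuous_invFun := (continuous_subtype_val.comp (B.Ψ.continuous.comp
    (continuous_fst.prodMk ((continuous_subtype_val.comp continuous_snd).subtype_mk _)))).subtype_mk _

/-- The coordinates of a point of `N₋`, with interval coordinate in `(-1, 0)`. [folklore] -/
def minusCoord (x : ↥B.cutData.minus) : ↥(B.τ ⁻¹' {0}) × Ioo (-1 : ℝ) 0 :=
  ((B.coordOf x (B.τ_mem_Ioo_of_mem_minus x.2)).1,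
    ⟨(B.coordOf x (B.τ_mem_Ioo_of_mem_minus x.2)).2, by
      rw [B.coe_snd_coordOf]; exact B.mem_minus_iff'.1 x.2⟩)

/-- The point of `N₋` with given coordinates. [folklore] -/
def minusPoint (q : ↥(B.τ ⁻¹' {0}) × Ioo (-1 : ℝ) 0) : ↥B.cutData.minus :=
  ⟨B.Ψ (q.1, ⟨q.2.1, q.2.2.1, by linarith [q.2.2.2]⟩), by rw [mem_minus_iff', B.τ_Ψ]; exact q.2.2⟩

/-- **`N₋ ≃ₜ L × (-1, 0)`.** [folklore] -/
def homeoMinus : ↥B.cutData.minus ≃ₜ ↥(B.τ ⁻¹' {0}) × Ioo (-1 : ℝ) 0 where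
  toFun := B.minusCoord
  invFun := B.minusPoint
  left_inv x := by
    apply Subtype.ext
    change (B.Ψ (_, _) : X) = x
    rw [show ((B.minusCoord x).1, (⟨((B.minusCoord x).2 : ℝ), (B.minusCoord x).2.2.1, by linarith [(B.minusCoord x).2.2.2]⟩ :
        Ioo (-1 : ℝ) 1)) = B.coordOf x (B.τ_mem_Ioo_of_mem_minus x.2) from Prod.ext rfl (Subtype.ext rfl)]
    exact B.Ψ_coordOf x _
  right_inv q := by
    have hc : B.coordOf (B.minusPoint q : X) (B.τ_mem_Ioo_of_mem_minus (B.minusPoint q).2) =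
        (q.1, ⟨q.2.1, q.2.2.1, by linarith [q.2.2.2]⟩) := B.coordOf_Ψ _ _
    refine Prod.ext ?_ (Subtype.ext ?_)
    · show (B.coordOf _ _).1 = q.1
      rw [hc]
    · show ((B.coordOf _ _).2 : ℝ) = q.2
      rw [hc]
  continuous_toFun := by
    refine Continuous.prodMk ?_ ?_
    · exact continuous_fst.comp (B.Ψ.symm.continuous.comp (continuous_subtype_val.subtype_mk _))
    · exact (continuous_subtype_val.comp (continuous_snd.comp
        (B.Ψ.symm.continuous.comp (continuous_subtype_val.subtype_mk _)))).subtype_mk _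
  continuous_invFun := (continuous_subtype_val.comp (B.Ψ.continuous.comp
    (continuous_fst.prodMk ((continuous_subtype_val.comp continuous_snd).subtype_mk _)))).subtype_mk _

/-- The inclusion `N₊ ↪ N` in coordinates is `L × (0, 1) ↪ L × (-1, 1)`. [folklore] -/
theorem homeoN_comp_inclusion_plus :
    (B.homeoN : C(↥B.cutData.N, ↥(B.τ ⁻¹' {0}) × Ioo (-1 : ℝ) 1)).comp (subsetInclusion B.cutData.plus_subset_N) =
      (inclIoo (a := -1) (b := 1) (c := 0) (d := 1) ↥(B.τ ⁻¹' {0}) (by norm_num) le_rfl).comp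
        (B.homeoPlus : C(↥B.cutData.plus, ↥(B.τ ⁻¹' {0}) × Ioo (0 : ℝ) 1)) := by
  ext x : 1
  exact Prod.ext rfl (Subtype.ext rfl)

/-- The inclusion `N₋ ↪ N` in coordinates is `L × (-1, 0) ↪ L × (-1, 1)`. [folklore] -/
theorem homeoN_comp_inclusion_minus :
    (B.homeoN : C(↥B.cutData.N, ↥(B.τ ⁻¹' {0}) × Ioo (-1 : ℝ) 1)).comp (subsetInclusion B.cutData.minus_subset_N) =
      (inclIoo (a := -1) (b := 1) (c := -1) (d := 0) ↥(B.τ ⁻¹' {0}) le_rfl (by norm_num)).comp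
        (B.homeoMinus : C(↥B.cutData.minus, ↥(B.τ ⁻¹' {0}) × Ioo (-1 : ℝ) 0)) := by
  ext x : 1
  exact Prod.ext rfl (Subtype.ext rfl)

/-! ### The homological hypotheses of the presentation -/

variable (R : Type) [CommRing R] (M : Type) [AddCommGroup M] [Module R M]

/-- Bijectivity on homology transported along homeomorphisms and a commuting square. [folklore] -/
theorem bijective_map_of_square {P Q P' Q' : Type u} [TopologicalSpace P] [TopologicalSpace Q]
    [TopologicalSpace P'] [TopologicalSpace Q'] (g : C(P, Q)) (g' : C(P', Q')) (eP : P ≃ₜ P') (eQ : Q ≃ₜ Q')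
    (h : (eQ : C(Q, Q')).comp g = g'.comp (eP : C(P, P'))) (n : ℕ)
    (hg' : Bijective (singularHomology.map R M g' n)) : Bijective (singularHomology.map R M g n) := by
  have hfac : singularHomology.map R M g n = singularHomology.map R M (eP : C(P, P')) n ≫
      singularHomology.map R M g' n ≫ singularHomology.map R M (eQ.symm : C(Q', Q)) n := by
    rw [← singularHomology.map_comp, ← singularHomology.map_comp, ContinuousMap.comp_assoc, ← h]
    rw [show (eQ.symm : C(Q', Q)).comp ((eQ : C(Q, Q')).comp g) = g from by
      ext x; exact eQ.symm_apply_apply (g x)]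
  rw [hfac]
  have hP : Bijective (singularHomology.map R M (eP : C(P, P')) n) :=
    ⟨fun a b hab => by simpa [map_homeomorph_symm_map] using congrArg (singularHomology.map R M (eP.symm : C(P', P)) n) hab,
      fun c => ⟨singularHomology.map R M (eP.symm : C(P', P)) n c, map_homeomorph_map_symm R M eP n c⟩⟩
  have hQ : Bijective (singularHomology.map R M (eQ.symm : C(Q', Q)) n) :=
    ⟨fun a b hab => by simpa [map_homeomorph_map_symm] using congrArg (singularHomology.map R M (eQ : C(Q, Q')) n) hab,
      fun c => ⟨singularHomology.map R M (eQ : C(Q, Q')) n c, map_homeomorph_symm_map R M eQ n c⟩⟩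
  have hcomp : ∀ x, (singularHomology.map R M (eP : C(P, P')) n ≫ singularHomology.map R M g' n ≫
      singularHomology.map R M (eQ.symm : C(Q', Q)) n) x =
      singularHomology.map R M (eQ.symm : C(Q', Q)) n (singularHomology.map R M g' n
        (singularHomology.map R M (eP : C(P, P')) n x)) := fun x => by
    rw [ModuleCat.comp_apply, ModuleCat.comp_apply]
  refine ⟨fun x y hxy => ?_, fun z => ?_⟩
  · rw [hcomp, hcomp] at hxy
    exact hP.1 (hg'.1 (hQ.1 hxy))
  · obtain ⟨c, rfl⟩ := hQ.2 z
    obtain ⟨b, rfl⟩ := hg'.2 c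
    obtain ⟨a, rfl⟩ := hP.2 b
    exact ⟨a, hcomp a⟩

/-- Path-connectedness passes along homeomorphisms. [folklore] -/
theorem pathConnectedSpace_of_homeomorph {P Q : Type*} [TopologicalSpace P] [TopologicalSpace Q]
    [PathConnectedSpace P] (e : P ≃ₜ Q) : PathConnectedSpace Q := by
  rw [pathConnectedSpace_iff_univ, ← e.surjective.range_eq]
  exact isPathConnected_range e.continuous

/-- Open intervals are path connected. [folklore] -/
theorem pathConnectedSpace_Ioo {a b : ℝ} (h : a < b) : PathConnectedSpace (Ioo a b) :=
  isPathConnected_iff_pathConnectedSpace.1 ((convex_Ioo a b).isPathConnected (nonempty_Ioo.2 h))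

/-- **`N₊` is path connected** when the cut `L = τ⁻¹(0)` is. [folklore] -/
theorem pathConnectedSpace_plus [PathConnectedSpace ↥(B.τ ⁻¹' {0})] : PathConnectedSpace ↥B.cutData.plus :=
  haveI := pathConnectedSpace_Ioo (zero_lt_one' ℝ)
  pathConnectedSpace_of_homeomorph B.homeoPlus.symm

/-- **`N₋` is path connected** when the cut is. [folklore] -/
theorem pathConnectedSpace_minus [PathConnectedSpace ↥(B.τ ⁻¹' {0})] : PathConnectedSpace ↥B.cutData.minus :=
  haveI := pathConnectedSpace_Ioo (show (-1 : ℝ) < 0 by norm_num)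
  pathConnectedSpace_of_homeomorph B.homeoMinus.symm

/-- **`N` is path connected** when the cut is. [folklore] -/
theorem pathConnectedSpace_N [PathConnectedSpace ↥(B.τ ⁻¹' {0})] : PathConnectedSpace ↥B.cutData.N :=
  haveI := pathConnectedSpace_Ioo (show (-1 : ℝ) < 1 by norm_num)
  pathConnectedSpace_of_homeomorph B.homeoN.symm

/-- **Hypothesis `hεp`** of `CutData.exists_presentation`: the augmentation of `N₊` is injective.
[folklore] -/
theorem ε_plus_injective [PathConnectedSpace ↥(B.τ ⁻¹' {0})] :
    Injective (singularHomology.ε R M ↥B.cutData.plus) :=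
  haveI := B.pathConnectedSpace_plus
  CutData.ε_injective_of_pathConnectedSpace (R := R) (M := M) (P := ↥B.cutData.plus)

/-- **Hypothesis `hεm`**: the augmentation of `N₋` is injective. [folklore] -/
theorem ε_minus_injective [PathConnectedSpace ↥(B.τ ⁻¹' {0})] :
    Injective (singularHomology.ε R M ↥B.cutData.minus) :=
  haveI := B.pathConnectedSpace_minus
  CutData.ε_injective_of_pathConnectedSpace (R := R) (M := M) (P := ↥B.cutData.minus)

/-- **Hypotheses `hjs`, `hjpi`**: `j₊ : Hₙ(N₊) → Hₙ(N)` is bijective (the inclusion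
`L × (0, 1) ↪ L × (-1, 1)` is a homotopy equivalence). [cite: Rolfsen1976, §8.C] -/
theorem jPlus_bijective (n : ℕ) : Bijective (B.cutData.jPlus R M n) :=
  bijective_map_of_square R M _ _ B.homeoPlus B.homeoN B.homeoN_comp_inclusion_plus n
    (bijective_map_inclIoo _ R M _ _ (zero_lt_one' ℝ) n)

/-- **Hypothesis `hjmi`** (and more): `j₋ : Hₙ(N₋) → Hₙ(N)` is bijective. [cite: Rolfsen1976, §8.C] -/
theorem jMinus_bijective (n : ℕ) : Bijective (B.cutData.jMinus R M n) :=
  bijective_map_of_square R M _ _ B.homeoMinus B.homeoN B.homeoN_comp_inclusion_minus n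
    (bijective_map_inclIoo _ R M _ _ (show (-1 : ℝ) < 0 by norm_num) n)

end BandData

end CyclicCover

end CircleMaps

end Literature.Topology.FourManifolds
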